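import Literature.Computability.Complexity.TVFunction
import HarnessLib

/-!
# Length arithmetic of Trevisan–Vadhan's `F`: the facts the oracle machine relies on

Literature / complexity — derandomization (Case 2 of IW98 in TV07 form); companion of `TVFunction.lean`
(the length layout `pre`, `slot`, `h n i`, parsers `nOf`, `iOf`, the field size `Mof n = log₂ (Dn n + 1)`,
the fine schedule `uops n`). The oracle machine for `F` (downward self-reducibility, TV07 Lemma 4.1 (i) /
IW98 Def. 6) parses `n`, `i` and `M` from the LENGTH of its input in unary and locates the operator
`(uops n)[i]`; this file proves the closed forms it computes:

* `QBFUniv.Mof_spec`, `QBFUniv.size_Dn_succ` — `2^M ≤ Dn n + 1 < 2^{M+1}`, so `M + 1` is the length of the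
  binary numeral of `Dn n + 1` (`Nat.size`); `QBFUniv.two_pow_Mof_succ_le`, `QBFUniv.Dn_succ_le` — the fuel
  `2^{M+1} ≤ 2 (Dn n + 1) ≤ 6 (ptLen n + 1)²` of the modulus search is polynomial in the input length;
* `QBFUniv.lt_nOf_iff`, **`QBFUniv.nOf_eq_card`** — `nOf k = #{t < k | pre (t+1) ≤ k}` (a count the machine
  folds in unary);
* **`QBFUniv.FB_cases`** — the three cases of `F` on a word of length `k` with `n = nOf k`: not canonical
  (`F = 0`), the last stage (`iOf k = mlen n`: the matrix, `Fni_mlen`), or a downward step (`iOf k < mlen n`,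
  query length `h n (iOf k + 1) < k`);
* `QBFUniv.length_ublockOps`, **`QBFUniv.uops_getElem_zero`**, **`QBFUniv.uops_getElem_succ`** — operator
  `b (N n + 1)` of the fine schedule is the quantifier of `x_b`, operator `b (N n + 1) + 1 + v` the
  linearization of variable `v`.

Everything is proved; no definitions beyond abbreviations, no named facts.

## References

* [TrevisanVadhan2007] L. Trevisan, S. Vadhan, Comput. Complexity 16 (2007), Lemma 4.1 (i), Thm. 4.3 (proof).
* [ImpagliazzoWigderson2001] R. Impagliazzo, A. Wigderson, JCSS 63 (2001), Def. 6 (downward self-reduction).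
-/

namespace Literature.Computability.Complexity

namespace QBFUniv

open Finset

/-! ### The field size -/

/-- `2^M ≤ Dn n + 1 < 2^{M+1}` for `M = Mof n`. [folklore] -/
theorem Mof_spec (n : ℕ) : 2 ^ Mof n ≤ Dn n + 1 ∧ Dn n + 1 < 2 ^ (Mof n + 1) :=
  ⟨Nat.pow_log_le_self 2 (Nat.succ_ne_zero _), Nat.lt_pow_succ_log_self (by norm_num) _⟩

/-- The binary numeral of `Dn n + 1` has `Mof n + 1` digits. [folklore] -/
theorem size_Dn_succ (n : ℕ) : (Dn n + 1).size = Mof n + 1 := by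
  obtain ⟨h1, h2⟩ := Mof_spec n
  apply le_antisymm
  · exact Nat.size_le.2 h2
  · exact Nat.lt_size.2 h1

/-- The fuel of the modulus search: `2^{M+1} ≤ 2 (Dn n + 1)`. [folklore] -/
theorem two_pow_Mof_succ_le (n : ℕ) : 2 ^ (Mof n + 1) ≤ 2 * (Dn n + 1) := by
  rw [pow_succ]; have := (Mof_spec n).1; omega

/-- `n ≤ N n`. [folklore] -/
theorem le_N (n : ℕ) : n ≤ N n := by rw [N_eq]; nlinarith

/-- `N n ≤ ptLen n`. [folklore] -/
theorem N_le_ptLen (n : ℕ) : N n ≤ ptLen n := by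
  rw [ptLen]; exact Nat.le_mul_of_pos_right _ (blk_pos n)

/-- The fuel is polynomial in the point length: `2 (Dn n + 1) ≤ 6 (ptLen n + 1)²`. [folklore] -/
theorem Dn_succ_le (n : ℕ) : 2 * (Dn n + 1) ≤ 6 * (ptLen n + 1) ^ 2 := by
  have h1 : Dn n ≤ N n * (2 * N n + 3) := by
    rw [Dn]; refine Nat.mul_le_mul_left _ ?_; have := le_N n; omega
  have h2 := N_le_ptLen n
  have h3 : N n * (2 * N n + 3) ≤ ptLen n * (2 * ptLen n + 3) := Nat.mul_le_mul h2 (by omega)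
  nlinarith

/-! ### The size parser as a count -/

/-- `t < nOf k ↔ pre (t + 1) ≤ k`. [folklore] -/
theorem lt_nOf_iff {k t : ℕ} : t < nOf k ↔ pre (t + 1) ≤ k := by
  obtain ⟨h1, h2⟩ := nOf_spec k
  constructor
  · intro h; exact (pre_mono h).trans h1
  · intro h
    by_contra hc
    exact absurd (h2.trans_le ((pre_mono (Nat.succ_le_succ (not_lt.1 hc))).trans h)) (lt_irrefl _)

/-- `nOf k ≤ k`. [folklore] -/
theorem nOf_le (k : ℕ) : nOf k ≤ k := by
  by_contra hc
  have := lt_nOf_iff.1 (not_le.1 hc)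
  have := le_pre (k + 1)
  omega

/-- **The size parser is a count**: `nOf k = #{t < k | pre (t+1) ≤ k}`. [folklore] -/
theorem nOf_eq_card (k : ℕ) : nOf k = ((range k).filter fun t => pre (t + 1) ≤ k).card := by
  have : (range k).filter (fun t => pre (t + 1) ≤ k) = range (nOf k) := by
    ext t
    simp only [mem_filter, mem_range]
    constructor
    · rintro ⟨-, h⟩; exact lt_nOf_iff.2 h
    · intro h; exact ⟨h.trans_le (nOf_le k), lt_nOf_iff.1 h⟩
  rw [this, card_range]

/-! ### The three cases of `F` by length -/

/-- `iOf k ≤ mlen (nOf k)`. [folklore] -/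
theorem iOf_le (k : ℕ) : iOf k ≤ mlen (nOf k) := Nat.sub_le _ _

/-- **The cases of `F` on a word**: with `n = nOf |w|`, either the length is not canonical and `F w = 0`,
or `F w = Fni n (iOf |w|) w` with `iOf |w| ≤ mlen n`, and when `iOf |w| < mlen n` the downward queries
(length `h n (iOf |w| + 1)`) are SHORTER than `w`. [cite: TrevisanVadhan2007, Thm. 4.3 (proof)] -/
theorem FB_cases (w : List Bool) :
    (¬ ptLen (nOf w.length) + blk (nOf w.length) ≤ w.length - pre (nOf w.length) ∧ FB w = false) ∨
    (ptLen (nOf w.length) + blk (nOf w.length) ≤ w.length - pre (nOf w.length) ∧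
      FB w = Fni (nOf w.length) (iOf w.length) w ∧
      (iOf w.length < mlen (nOf w.length) → h (nOf w.length) (iOf w.length + 1) < w.length)) := by
  by_cases hc : ptLen (nOf w.length) + blk (nOf w.length) ≤ w.length - pre (nOf w.length)
  · refine Or.inr ⟨hc, by rw [FB, if_pos hc], fun hi => ?_⟩
    have h1 := (nOf_spec w.length).1
    rw [h, iOf] at *
    omega
  · exact Or.inl ⟨hc, by rw [FB, if_neg hc]⟩

/-- In the canonical case the stage is exact unless the word is overlong (then the stage is `0`).
[folklore] -/
theorem h_nOf_iOf (w : List Bool) (hc : ptLen (nOf w.length) + blk (nOf w.length) ≤ w.length - pre (nOf w.length)) :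
    h (nOf w.length) (iOf w.length) = w.length ∨ (iOf w.length = 0 ∧ h (nOf w.length) 0 < w.length) := by
  have h1 := (nOf_spec w.length).1
  by_cases he : w.length - pre (nOf w.length) - ptLen (nOf w.length) - blk (nOf w.length) ≤ mlen (nOf w.length)
  · left; rw [h, iOf]; omega
  · right; rw [h, iOf]; omega

/-! ### Locating an operator of the fine schedule -/

/-- A block of the fine schedule has `N n + 1` operators. [folklore] -/
@[simp] theorem length_ublockOps (n : ℕ) (b : Fin n) : (ublockOps n b).length = N n + 1 := by
  simp [ublockOps]

/-- Indexing a flattened list of blocks of equal length. [folklore] -/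
theorem getElem_flatten_of_length {α : Type*} (L : List (List α)) (c : ℕ) (hL : ∀ l ∈ L, l.length = c)
    (b t : ℕ) (hb : b < L.length) (ht : t < c) (hi : b * c + t < L.flatten.length) :
    L.flatten[b * c + t] = (L[b])[t]'(by rw [hL _ (List.getElem_mem hb)]; exact ht) := by
  induction L generalizing b with
  | nil => simp at hb
  | cons l L ih =>
    have hl : l.length = c := hL l (by simp)
    rcases b with _ | b
    · simp only [List.flatten_cons, zero_mul, zero_add, List.getElem_cons_zero]
      exact List.getElem_append_left (by rw [hl]; exact ht)
    · simp only [List.flatten_cons, List.getElem_cons_succ]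
      have hb' : b < L.length := by simpa using hb
      have e : (b + 1) * c + t = l.length + (b * c + t) := by rw [hl]; ring
      have hi' : b * c + t < L.flatten.length := by
        have := hi; rw [List.flatten_cons, List.length_append, e] at this; omega
      simp only [e]
      rw [List.getElem_append_right (by omega)]
      simp only [Nat.add_sub_cancel_left]
      exact ih (fun l' hl' => hL l' (by simp [hl'])) b hb' hi'

/-- Operator `b (N n + 1) + t` of the fine schedule is operator `t` of block `b`. [folklore] -/
theorem uops_getElem (n : ℕ) (b : Fin n) (t : ℕ) (ht : t < N n + 1) (hi : b.val * (N n + 1) + t < (uops n).length) :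
    (uops n)[b.val * (N n + 1) + t] = (ublockOps n b)[t]'(by rw [length_ublockOps]; exact ht) := by
  have hL : ∀ l ∈ (List.finRange n).map (ublockOps n), l.length = N n + 1 := by
    intro l hl
    obtain ⟨b', -, rfl⟩ := List.mem_map.1 hl
    exact length_ublockOps n b'
  have hb : b.val < ((List.finRange n).map (ublockOps n)).length := by simp
  have := getElem_flatten_of_length ((List.finRange n).map (ublockOps n)) (N n + 1) hL b.val t hb ht (by rwa [uops] at hi)
  simp only [uops]
  rw [this]
  congr 1
  simp

/-- The index of the quantifier of block `b` is in range. [folklore] -/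
theorem blockStart_lt (n : ℕ) (b : Fin n) : b.val * (N n + 1) < (uops n).length := by
  rw [length_uops]
  have := b.isLt
  calc b.val * (N n + 1) < (b.val + 1) * (N n + 1) := by nlinarith
    _ ≤ n * (N n + 1) := Nat.mul_le_mul_right _ this

/-- The index of linearization `v` of block `b` is in range. [folklore] -/
theorem blockLin_lt (n : ℕ) (b : Fin n) (v : Fin (N n)) : b.val * (N n + 1) + (v.val + 1) < (uops n).length := by
  rw [length_uops]
  have hb := b.isLt
  have hv := v.isLt
  calc b.val * (N n + 1) + (v.val + 1) < b.val * (N n + 1) + (N n + 1) := by omega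
    _ = (b.val + 1) * (N n + 1) := by ring
    _ ≤ n * (N n + 1) := Nat.mul_le_mul_right _ hb

/-- **The quantifier of block `b`** sits at index `b (N n + 1)`. [cite: TrevisanVadhan2007, Lemma 4.1 (proof)] -/
theorem uops_getElem_zero (n : ℕ) (b : Fin n) :
    (uops n)[b.val * (N n + 1)]'(blockStart_lt n b) = UOp.quant b := by
  have := uops_getElem n b 0 (Nat.succ_pos _) (by simpa using blockStart_lt n b)
  simp only [add_zero] at this
  rw [this]
  simp [ublockOps]

/-- **Linearization `v` of block `b`** sits at index `b (N n + 1) + 1 + v`. [cite: TrevisanVadhan2007, Lemma 4.1 (proof)] -/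
theorem uops_getElem_succ (n : ℕ) (b : Fin n) (v : Fin (N n)) :
    (uops n)[b.val * (N n + 1) + (v.val + 1)]'(blockLin_lt n b v) = UOp.lin v := by
  rw [uops_getElem n b (v.val + 1) (by have := v.isLt; omega) (blockLin_lt n b v)]
  simp [ublockOps]

/-- Every index `i < mlen n` decomposes as `b (N n + 1) + t` with `b < n`, `t ≤ N n`. [folklore] -/
theorem exists_block_of_lt_mlen {n i : ℕ} (hi : i < mlen n) :
    ∃ b : Fin n, ∃ t : ℕ, t < N n + 1 ∧ i = b.val * (N n + 1) + t := by
  rw [mlen, length_uops] at hi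
  have hn : 0 < n := Nat.pos_of_ne_zero fun h0 => by rw [h0] at hi; simp at hi
  refine ⟨⟨i / (N n + 1), (Nat.div_lt_iff_lt_mul (Nat.succ_pos _)).2 hi⟩, i % (N n + 1), Nat.mod_lt _ (Nat.succ_pos _), ?_⟩
  exact (Nat.div_add_mod' i (N n + 1)).symm.trans (by ring)

end QBFUniv

end Literature.Computability.Complexity
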